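import Literature.MathematicalPhysics.QuantumLattice.HubbardTTPrimeMultilinearBoxWordAdapters
import Literature.MathematicalPhysics.QuantumLattice.HubbardTTPrimeBoxWordExtension
import Literature.MathematicalPhysics.QuantumLattice.HubbardNNNHoppingEnergyDensityRegionBounds
import HarnessLib

/-!
# Ventures/CertifiedManyBodySolver — Certificates/HubbardSquare_transportClosure_KitN.lean
# (hubbard-fast-reuse-1 g0, cell hubbard-fast, D-0154 (A) CERTIFICATE REUSE: the TRANSPORT-CLOSURE kit, part 3 = density-side
# companions used as the NON-LEVER side of cell words)

* `tc_mlFloor_nVacuumSecx` — convexity of `e₀` in `n` with the exact vacuum anchor `e(t,s,U,0) ≤ 0`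
  (`energyDensityTT'_density_zero_le`): a bilinear floor `A(U,s) ≤ e(t,s,U,n_A)` at one density plane `n_A > 0` floors every
  `n ≥ n_A` by the secant extension `e(n) ≥ A·(n/n_A)` (`energyDensityTT'_ge_density_extrapolate_right` with `n₀ = 0, R₀ = 0`),
  written in the 8-coefficient `_mlword_Icc` shape (only the `θ2`-carrying monomials are non-zero).
HONEST FRAMING: bookkeeping adapter; certifies nothing by itself; consumers inherit exactly the hypotheses of the words they cite;
no number of record; not a phase word; no summit statement is proved here; not a superconductivity verdict.
-/

namespace Summit.Ventures.CertifiedManyBodySolver.Certificates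

open Literature.MathematicalPhysics.QuantumLattice
open Literature.MathematicalPhysics.QuantumLattice.ThermodynamicLimit
open Set

/-- **VACUUM-SECANT FLOOR above a density plane** (convexity of `e₀` in `n`, anchor `e(·,·,·,0) ≤ 0`): from a bilinear floor
`A(U,s) ≤ e(t,s,U,n_A)` (`n_A > 0`) on `U ∈ [Ua,Ub]` (`Ua ≥ 0`), `s ∈ [s₁,s₂]`: for `n_A ≤ na ≤ θ2 ≤ nb < 2`,
`(A(θ0,θ1)/n_A)·θ2 ≤ e(t,θ1,θ0,θ2)`. [cite: LiebWuPhysicaA2003, §7] -/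
theorem tc_mlFloor_nVacuumSecx (t : ℝ) {nA Ua Ub s₁ s₂ na nb α₀ α₁ α₂ α₃ : ℝ}
    (hUa : 0 ≤ Ua) (hnA : 0 < nA) (ha : nA ≤ na) (hnb : nb < 2)
    (hA : ∀ U s : ℝ, Ua ≤ U → U ≤ Ub → s₁ ≤ s → s ≤ s₂ →
      α₀ + α₁ * U + α₂ * s + α₃ * U * s ≤ energyDensityTT' t s U nA) :
    ∀ θ ∈ Set.Icc (![Ua, s₁, na] : Fin 3 → ℝ) ![Ub, s₂, nb],
      0 + 0 * θ 0 + 0 * θ 1 + (α₀ / nA) * θ 2 + 0 * θ 0 * θ 1 + (α₁ / nA) * θ 0 * θ 2 + (α₂ / nA) * θ 1 * θ 2 +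
        (α₃ / nA) * θ 0 * θ 1 * θ 2 ≤ energyDensityTT' t (θ 1) (θ 0) (θ 2) := by
  intro θ hθ
  obtain ⟨⟨k1, k2⟩, ⟨k3, k4⟩, ⟨k5, k6⟩⟩ := mem_Icc_vec3_iff.1 hθ
  have hU0 : 0 ≤ θ 0 := hUa.trans k1
  have hA' := hA (θ 0) (θ 1) k1 k2 k3 k4
  have hn2 : θ 2 < 2 := lt_of_le_of_lt k6 hnb
  have hnA0 : nA ≠ 0 := hnA.ne'
  have key : 0 + 0 * θ 0 + 0 * θ 1 + (α₀ / nA) * θ 2 + 0 * θ 0 * θ 1 + (α₁ / nA) * θ 0 * θ 2 + (α₂ / nA) * θ 1 * θ 2 +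
      (α₃ / nA) * θ 0 * θ 1 * θ 2 = (α₀ + α₁ * θ 0 + α₂ * θ 1 + α₃ * θ 0 * θ 1) * θ 2 / nA := by
    field_simp
    ring
  rw [key]
  rcases eq_or_lt_of_le (ha.trans k5) with h0 | h0
  · -- θ 2 = nA
    rw [← h0]
    have : (α₀ + α₁ * θ 0 + α₂ * θ 1 + α₃ * θ 0 * θ 1) * nA / nA = α₀ + α₁ * θ 0 + α₂ * θ 1 + α₃ * θ 0 * θ 1 := by
      field_simp
    rw [this]
    exact hA'
  · have h := energyDensityTT'_ge_density_extrapolate_right t (θ 1) hU0 (n₀ := 0) (n₁ := nA) (n := θ 2)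
      (R₀ := 0) (L₁ := α₀ + α₁ * θ 0 + α₂ * θ 1 + α₃ * θ 0 * θ 1) le_rfl hnA h0 hn2
      (energyDensityTT'_density_zero_le t (θ 1) hU0) hA'
    have e1 : (α₀ + α₁ * θ 0 + α₂ * θ 1 + α₃ * θ 0 * θ 1) +
        ((α₀ + α₁ * θ 0 + α₂ * θ 1 + α₃ * θ 0 * θ 1) - 0) * (θ 2 - nA) / (nA - 0) =
        (α₀ + α₁ * θ 0 + α₂ * θ 1 + α₃ * θ 0 * θ 1) * θ 2 / nA := by
      field_simp
      ring
    rw [e1] at h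
    exact h

end Summit.Ventures.CertifiedManyBodySolver.Certificates
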